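import Summits.Ventures.Crystal3D.Theorems.StickyWulffConstantGenericWallFloorBarlowReach
import Summits.Ventures.Crystal3D.Theorems.StickyWulffConstantGenericWallFloorStackWalkForcedChain
import HarnessLib

/-!
# A Barlow plate lies in the reach set of its CHAIN FRAMES (F4, G-side: the frame set `M₁ = chainFrames z L v₀` by name)
# (crux `GenericWallFloor`, stmt-Ventures-19480, line `WallLedgerG`; lane T's F4, cf-p1 §86(58) BA)

HONEST FRAMING. Venture `Summits/Ventures/Crystal3D` (cell `crystal3d-full`), helper `--supports` the crux `GenericWallFloor`
(stmt-Ventures-19480) of `route-Ventures-StickyWulffConstant`, registered line `WallLedgerG`, open stub `stub_twoSlabAdhesion`.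
Rung credit only; F-C1 not moved; NOT the stub.

F4 runs the cap-started walkers of a Barlow plate with bottom entry `⟨L, v₀, 0⟩`; every frame they ever carry lies in
`chainFrames z L v₀` (`frame_mem_chainFrames_of_stack`, `…StackWalkForcedChain`), so that is the frame set `M₁` of
`walkRun_fst_mem_reachSet` / `walkEnd_not_high_barlow`.  `barlow_mem_reachSet` (`…BarlowReach`) puts the whole moved plate into
`reachSet L t M` for any `M ∋ L, twinFrame L (L e₃)`; here:

* `twinFrame_axis_mem_chainFrames` — the ∇ frame `twinFrame L (L e₃)` is a chain frame of `(L, v₀)` for every upper slot `v₀`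
  (level `0` of the forced ray through the menu normal `L e₃`);
* **`barlow_mem_reachSet_chainFrames`** — every site `L·barlowPos σ k i j + s₀` lies in
  `reachSet L (L (haggLabel σ 0 · w) + s₀) (chainFrames z L v₀)`; hence every START ball and (by `walkRun_fst_mem_reachSet`) every
  END ball of the plate's walker family lies there, and the off-registry hypothesis of F4 reads
  `reachSet L₁ t₁ (chainFrames e₃ L₁ v₀) ∩ stacking L₂ s₂ σ₂ = ∅` (and symmetrically).
WHAT THIS IS NOT: no registry analysis (which pairs satisfy the off-registry hypothesis is lane F/T business); F-C1 not moved.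
-/

noncomputable section

namespace Summit.Ventures.Crystal3D.Theorems

open Finset
open Literature.MathematicalPhysics.StatisticalMechanics
open scoped InnerProductSpace

/-- **The ∇ frame is a chain frame.**  For an upper slot `v₀` (`v₀ ₂ = √(2/3)`), `twinFrame L (L e₃) ∈ chainFrames z L v₀`. -/
theorem twinFrame_axis_mem_chainFrames (z : EuclideanSpace ℝ (Fin 3)) (L : EuclideanSpace ℝ (Fin 3) ≃ₗᵢ[ℝ] EuclideanSpace ℝ (Fin 3))
    {v₀ : EuclideanSpace ℝ (Fin 3)} (hv₀2 : v₀ 2 = Real.sqrt (2 / 3)) :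
    twinFrame L (L (EuclideanSpace.single (2 : Fin 3) (1 : ℝ))) ∈ chainFrames z L v₀ := by
  have he : ‖EuclideanSpace.single (2 : Fin 3) (1 : ℝ)‖ = 1 := by rw [PiLp.norm_single, norm_one]
  refine Or.inr ⟨L (EuclideanSpace.single (2 : Fin 3) (1 : ℝ)), by rw [LinearIsometryEquiv.norm_map, he],
    fun w hw => ?_, by rw [inner_frame_axis, hv₀2], 0, ?_⟩
  · rw [inner_frame_axis]; exact slot_apply_two_cases hw
  · rw [forcedTop_zero]; rfl

/-- **A moved Barlow plate lies in the reach set of its chain frames.** -/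
theorem barlow_mem_reachSet_chainFrames (z : EuclideanSpace ℝ (Fin 3))
    (L : EuclideanSpace ℝ (Fin 3) ≃ₗᵢ[ℝ] EuclideanSpace ℝ (Fin 3)) (s₀ : EuclideanSpace ℝ (Fin 3))
    {σ : ℤ → ℤ} (hσ : IsHaggSeq σ) {v₀ : EuclideanSpace ℝ (Fin 3)} (hv₀2 : v₀ 2 = Real.sqrt (2 / 3)) (k i j : ℤ) :
    L (barlowPos 1 (Real.sqrt (2 / 3)) σ k i j) + s₀ ∈
      reachSet L (L ((haggLabel σ 0 : ℝ) • barlowOffset 1) + s₀) (chainFrames z L v₀) :=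
  barlow_mem_reachSet L s₀ hσ (self_mem_chainFrames z L v₀) (twinFrame_axis_mem_chainFrames z L hv₀2) k i j

end Summit.Ventures.Crystal3D.Theorems

end
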